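import Summits.BirchSwinnertonDyer.BirchSwinnertonDyer.Theorems.PrintX11aLowerHalfMuAnEvenBranch
import Literature.NumberTheory.EllipticCurves.PAdicLFunctionMultBranchInterpolationProofs
import HarnessLib

/-!
# Crux `X11aLowerHalf` (item stmt-BirchSwinnertonDyer-19064), registered stub `stub_muAnSurjDeepFive` — part 1 of 2: the ONE-TERM
# Mazur–Tate–Teitelbaum measure `μ⁺_{f,α}` at `p ∣ N` in BRANCH (`μ`-invariant) currency — `μ(L⁺_p(f, α, ω⁰)) = 0 ⟺` a unit
# Teichmüller orbit sum, and «a unit plus symbol ⟹ SOME EVEN branch `ω^i` has `μ = 0`»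

Cell `bsd-print-x11a`, width seat bsd-line-x11a-p1-w6 («width 6»; `--supports stmt-BirchSwinnertonDyer-19064`, helper).  THEOREMS ONLY (no
definition, no named fact, no `sorry`); nothing here is specific to a curve: `f` is any weight-2 cusp form on `Γ₀(N)`, `α ∈ ℚ_p` with
`‖α‖_p = 1`, and the hypotheses are the distribution law of `μ⁺_{f,α} = msdPlusMeasureMult f α` (`μ⁺(a + pⁿℤ_p) = α⁻ⁿ[a/pⁿ]⁺_f`, MTT §I.10
(10.1) with `ε(p) = 0` — the measure of the newform of an elliptic curve at a prime of MULTIPLICATIVE reduction, `α = a_p = ±1`) and the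
`p`-integrality of the plus symbols `[a/pⁿ]⁺_f`.  Part 2 (`PrintX11aLowerHalfMuAnBranchDichotomy`) feeds these to the newform of an X11a pair.
This is the multiplicative twin of `Literature/…/PAdicLFunctionBranchMuCertificateProofs.lean` §2 (two-term measure `msdMeasure`, good ordinary
`p`, consumed by bsd-f3-mu's `Theorems/PrintX9EvenBranchMuZeroInputFree.lean`); the ABSTRACT half of that file (§1, any bounded distribution on
the tower) and of `PAdicLFunctionMuInvariantCertificateProofs` (§1–§2) is used as is.

* `msdPlusMeasureMult_neg` — `μ⁺_{f,α}` is EVEN (`[−r]⁺ = [r]⁺`, periodicity).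
* `finsum_msdPlusMeasureMult_coset_eq` — the `ω⁰` orbit sums of `μ⁺` over a Teichmüller coset `u·μ_{p−1} ⊂ (ℤ/p^{n+e₀})ˣ` ARE
  `α^{−(n+e₀)}·A(u)`, `A(u) = Σ_{t^{p−1}=1} [tu/p^{n+e₀}]⁺_f = Rank1Residual.teichOrbitSum f p (n+e₀) u` (U5's S3 currency
  `MultTeich.MultTeichOrbitUnitAt`, `Theorems/PrintX11aUpperNonSurjFiveMultTeichDefs.lean`).
* `exists_norm_coeff_branch_zero_eq_one_of_teichOrbitSum` ∕ `exists_teichOrbitSum_unit_of_norm_coeff_branch_zero` — THE `ω⁰` DICTIONARY: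
  a unit orbit sum `A(u)` (`u` a unit mod `p^{n+e₀}`) ⟹ a unit coefficient of `L⁺_p(f, α, ω⁰, T) = padicLFunctionPlusBranchMult f α 0` below
  degree `pⁿ`; conversely a unit coefficient ⟹ a unit orbit sum at some level `m ≥ 1` (all orbit sums in the ball `p⁻¹` ⟹ all coefficients
  in that ball).  So «`μ(L⁺_p(f, α, ω⁰)) = 0` ⟺ some `A_m(a)`, `m ≥ 1`, `a` a unit, is a `p`-adic unit».
* `exists_even_branch_norm_coeff_eq_one_of_unit_symbol` — a unit plus symbol `[u/p^{n+e₀}]⁺_f` at a unit `u` forces an EVEN `i < p − 1` and a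
  `k` with `‖[Tᵏ] L⁺_p(f, α, ω^i, T)‖_p = 1`, where `i = 0` only if `A(u)` itself is a unit (orthogonality of the tame characters over
  `μ_{p−1}(ℤ_p)`, evenness kills odd `i`, the branch certificate).

HONEST SCOPE: bookkeeping in the kernel (MTT §I.13's decomposition `ℤ_p⟦ℤ_pˣ⟧ = ⊕_i e_i ℤ_p⟦Γ⟧` for the one-term measure); beyond-print theorem:
no; closes nothing; PARTITION 0.  BSD is not proved by any of this.
References: [MazurTateTeitelbaum1986Invent] §I.10 (10.1), §I.11–I.13; [Washington1997] §5.1, §7.2; [GreenbergVatsal2000] §3 (2)–(3).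
-/

set_option linter.dupNamespace false
set_option autoImplicit false

noncomputable section

open scoped MatrixGroups ModularForm
open Filter Topology
open CongruenceSubgroup
  Literature.NumberTheory.EllipticCurves Literature.NumberTheory.EllipticCurves.ModularForms
  Literature.NumberTheory.EllipticCurves.Rank1Residual
  Summit.BirchSwinnertonDyer.Rank1Residual
  Summit.BirchSwinnertonDyer.BirchSwinnertonDyer.Cruxes.UpperNonSurjFive.MultTeich
  Summit.BirchSwinnertonDyer.BirchSwinnertonDyer.Cruxes.AnalyticMuZeroX9.TeichSpan

namespace Summit.BirchSwinnertonDyer.BirchSwinnertonDyer.Theorems.X11aLowerHalfBranch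

/-! ### §1 The one-term plus measure `μ⁺_{f,α}` at `p ∣ N`: evenness, orbit sums, the `ω⁰` dictionary, the even-branch certificate -/

section OneTerm

variable {p : ℕ} [Fact p.Prime] {N : ℕ} (f : CuspForm (Gamma0 N) 2) (α : ℚ_[p])

/-- **`μ⁺_{f,α}` is EVEN**: `μ⁺(−a + pᴸℤ_p) = μ⁺(a + pᴸℤ_p)` (representatives in `[0, pᴸ)`: `[(pᴸ − a)/pᴸ]⁺ = [−a/pᴸ + 1]⁺ = [a/pᴸ]⁺`,
periodicity `ratPlusSymbol_add_intCast_eq` and evenness `ratPlusSymbol_neg`).  One-term twin of `msdMeasure_neg`.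
[cite: MazurTateTeitelbaum1986Invent, §I.10 (10.1) with ε(p) = 0, §I.8] -/
theorem msdPlusMeasureMult_neg [NeZero N] (L : ℕ) (a : ZMod (p ^ L)) :
    msdPlusMeasureMult f α L (-a) = msdPlusMeasureMult f α L a := by
  have hp : p.Prime := Fact.out
  by_cases ha : a = 0
  · subst ha; rw [neg_zero]
  haveI : NeZero (p ^ L) := ⟨pow_ne_zero _ hp.ne_zero⟩
  have hval : (-a).val = p ^ L - a.val := by rw [ZMod.neg_val, if_neg ha]
  have hle : a.val ≤ p ^ L := (ZMod.val_lt a).le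
  have hcast : (((-a).val : ℕ) : ℚ) = (p : ℚ) ^ L - (a.val : ℚ) := by
    rw [hval, Nat.cast_sub hle]; push_cast; ring
  have hp0 : (p : ℚ) ^ L ≠ 0 := pow_ne_zero _ (by exact_mod_cast hp.ne_zero)
  have e : (((-a).val : ℕ) : ℚ) / (p : ℚ) ^ L = -((a.val : ℚ) / (p : ℚ) ^ L) + ((1 : ℤ) : ℚ) := by
    rw [hcast]; push_cast; field_simp; ring
  simp only [msdPlusMeasureMult]
  rw [e, ratPlusSymbol_add_intCast_eq, ratPlusSymbol_neg]

/-- **The `ω⁰` orbit sums of `μ⁺_{f,α}` ARE the Teichmüller orbit sums of the plus symbols**: for a unit class `u = ξ̄₀·γ^{s₀} mod p^{n+e₀}`,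
`Σ_ξ μ⁺(ξ̄ γ^{s₀} + p^{n+e₀}ℤ_p) = α^{−(n+e₀)} · A(u)`, `A(u) = Σ_{t^{p−1}=1} [tu/p^{n+e₀}]⁺_f = Rank1Residual.teichOrbitSum` (the coset
`{ξ̄ γ^{s₀}}` is `{b : b^{p−1} = u^{p−1}} = u·μ_{p−1}`: `X11a.MuCoset.finsum_coset_eq_sum_filter`, `MultTeich.sum_filter_pow_eq_one_mul_eq`).
[cite: MazurTateTeitelbaum1986Invent, §I.10 (10.1), §I.13] [cite: Washington1997, §5.1] -/
theorem finsum_msdPlusMeasureMult_coset_eq (hp2 : p ≠ 2) (n : ℕ) (ξ₀ : rootsOfUnity (torsionOrder p) ℤ_[p])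
    (s₀ : ZMod (p ^ n)) (u : (ZMod (p ^ (n + cyclotomicExponent p)))ˣ)
    (hξs : PadicInt.toZModPow (n + cyclotomicExponent p) ((ξ₀ : ℤ_[p]ˣ) : ℤ_[p]) *
        (cyclotomicGenerator p : ZMod (p ^ (n + cyclotomicExponent p))) ^ s₀.val =
      (u : ZMod (p ^ (n + cyclotomicExponent p)))) :
    (∑ᶠ ξ : rootsOfUnity (torsionOrder p) ℤ_[p], msdPlusMeasureMult f α (n + cyclotomicExponent p)
        (PadicInt.toZModPow (n + cyclotomicExponent p) ((ξ : ℤ_[p]ˣ) : ℤ_[p]) *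
          (cyclotomicGenerator p : ZMod (p ^ (n + cyclotomicExponent p))) ^ s₀.val)) =
      α⁻¹ ^ (n + cyclotomicExponent p) *
        ((teichOrbitSum f p (n + cyclotomicExponent p) (u : ZMod (p ^ (n + cyclotomicExponent p))) : ℚ) :
          ℚ_[p]) := by
  classical
  have hτ : torsionOrder p = p - 1 := by rw [torsionOrder_eq, if_neg hp2]
  have hupow : (u : ZMod (p ^ (n + cyclotomicExponent p))) ^ torsionOrder p =
      (cyclotomicGenerator p : ZMod (p ^ (n + cyclotomicExponent p))) ^ (torsionOrder p * s₀.val) := by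
    rw [← hξs, mul_pow, ← map_pow, rootsOfUnity_pow_torsionOrder, map_one, one_mul, ← pow_mul, mul_comm]
  rw [X11a.MuCoset.finsum_coset_eq_sum_filter p hp2 n s₀
    (fun b ↦ msdPlusMeasureMult f α (n + cyclotomicExponent p) b), ← hupow, hτ,
    ← sum_filter_pow_eq_one_mul_eq u, teichOrbitSum_def]
  simp only [msdPlusMeasureMult]
  rw [← Finset.mul_sum, Rat.cast_sum]

variable {f α}

/-- **Dictionary, forward: a unit orbit sum forces `μ(L⁺_p(f, α, ω⁰)) = 0`** (`p` odd, `μ⁺_{f,α}` a `ℤ_p`-valued distribution, `‖α‖_p = 1`):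
if `A(u)` is a `p`-adic unit for a unit `u mod p^{n+e₀}`, some coefficient of the `ω⁰` branch (below degree `pⁿ`) is a `p`-adic unit —
the abstract certificate `exists_lt_norm_limUnder_riemannSum_of_lt_norm_orbitSum` fed the one-term measure.
[cite: MazurTateTeitelbaum1986Invent, §I.11–I.13] -/
theorem exists_norm_coeff_branch_zero_eq_one_of_teichOrbitSum (hp2 : p ≠ 2) (hα : ‖α‖ = 1)
    (hdist : ∀ (n : ℕ) (a : ZMod (p ^ n)),
      ∑ b ∈ Finset.univ.filter (fun b : ZMod (p ^ (n + 1)) ↦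
        ZMod.castHom (pow_dvd_pow p n.le_succ) (ZMod (p ^ n)) b = a), msdPlusMeasureMult f α (n + 1) b =
        msdPlusMeasureMult f α n a)
    (hint : ∀ (n : ℕ) (a : ZMod (p ^ n)), ‖((ratPlusSymbol f ((a.val : ℚ) / (p : ℚ) ^ n) : ℚ) : ℚ_[p])‖ ≤ 1)
    (n : ℕ) (u : (ZMod (p ^ (n + cyclotomicExponent p)))ˣ)
    (hu : 1 ≤ ‖((teichOrbitSum f p (n + cyclotomicExponent p) (u : ZMod (p ^ (n + cyclotomicExponent p))) : ℚ) :
      ℚ_[p])‖) :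
    ∃ k < p ^ n, ‖PowerSeries.coeff k (padicLFunctionPlusBranchMult f α 0)‖ = 1 := by
  classical
  have hp : p.Prime := Fact.out
  have hαinv : ∀ m : ℕ, ‖α⁻¹ ^ m‖ = 1 := fun m ↦ by rw [norm_pow, norm_inv, hα, inv_one, one_pow]
  have hintμ : ∀ (m : ℕ) (a : ZMod (p ^ m)), ‖msdPlusMeasureMult f α m a‖ ≤ 1 := fun m a ↦ by
    simp only [msdPlusMeasureMult]; rw [norm_mul, hαinv, one_mul]; exact hint m a
  have hRS : ∀ k m : ℕ, padicLPlusBranchMultRiemannSum f α 0 k m =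
      ∑ᶠ ξ : rootsOfUnity (torsionOrder p) ℤ_[p], ∑ s : ZMod (p ^ m),
        msdPlusMeasureMult f α (m + cyclotomicExponent p)
            (PadicInt.toZModPow (m + cyclotomicExponent p) ((ξ : ℤ_[p]ˣ) : ℤ_[p]) *
              (cyclotomicGenerator p : ZMod (p ^ (m + cyclotomicExponent p))) ^ s.val) *
          ((s.val.choose k : ℕ) : ℚ_[p]) := fun k m ↦ by
    unfold padicLPlusBranchMultRiemannSum; simp only [pow_zero, one_mul]
  obtain ⟨ξ₀, s₀, hξs⟩ := X11a.MuCoset.exists_classMap_eq p n u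
  have hs₀ : (1 : ℝ) * (p : ℝ)⁻¹ < ‖∑ᶠ ξ : rootsOfUnity (torsionOrder p) ℤ_[p],
      msdPlusMeasureMult f α (n + cyclotomicExponent p)
        (PadicInt.toZModPow (n + cyclotomicExponent p) ((ξ : ℤ_[p]ˣ) : ℤ_[p]) *
          (cyclotomicGenerator p : ZMod (p ^ (n + cyclotomicExponent p))) ^ s₀.val)‖ := by
    rw [finsum_msdPlusMeasureMult_coset_eq f α hp2 n ξ₀ s₀ u hξs, norm_mul, hαinv, one_mul, one_mul]
    calc (p : ℝ)⁻¹ < 1 := inv_lt_one_of_one_lt₀ (by exact_mod_cast hp.one_lt)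
      _ ≤ _ := hu
  obtain ⟨k, hk, hbig⟩ := exists_lt_norm_limUnder_riemannSum_of_lt_norm_orbitSum
    (μ := msdPlusMeasureMult f α) (RS := padicLPlusBranchMultRiemannSum f α 0) hRS hdist hintμ hs₀
  rw [one_mul] at hbig
  have hle := norm_coeff_padicLFunctionPlusBranchMult_le f α hdist hintμ 0 k
  rw [coeff_padicLFunctionPlusBranchMult] at hle
  refine ⟨k, hk, ?_⟩
  rw [coeff_padicLFunctionPlusBranchMult]
  exact norm_eq_one_of_inv_lt_of_le_one hbig hle

/-- **Dictionary, converse: `μ(L⁺_p(f, α, ω⁰)) = 0` forces a unit orbit sum** (same hypotheses): if NO orbit sum `A_m(a)`, `m ≥ 1`, `a` a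
unit, is a `p`-adic unit, then all `ω⁰` orbit sums of `μ⁺` lie in the ball `p⁻¹` (`finsum_msdPlusMeasureMult_coset_eq` at `u = γ^s`), hence
so does every coefficient (`norm_limUnder_riemannSum_le_of_forall_norm_orbitSum_sub_le`). [cite: MazurTateTeitelbaum1986Invent, §I.11–I.13] -/
theorem exists_teichOrbitSum_unit_of_norm_coeff_branch_zero (hp2 : p ≠ 2) (hα : ‖α‖ = 1)
    (hdist : ∀ (n : ℕ) (a : ZMod (p ^ n)),
      ∑ b ∈ Finset.univ.filter (fun b : ZMod (p ^ (n + 1)) ↦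
        ZMod.castHom (pow_dvd_pow p n.le_succ) (ZMod (p ^ n)) b = a), msdPlusMeasureMult f α (n + 1) b =
        msdPlusMeasureMult f α n a)
    (hint : ∀ (n : ℕ) (a : ZMod (p ^ n)), ‖((ratPlusSymbol f ((a.val : ℚ) / (p : ℚ) ^ n) : ℚ) : ℚ_[p])‖ ≤ 1)
    {k : ℕ} (hk : 1 ≤ ‖PowerSeries.coeff k (padicLFunctionPlusBranchMult f α 0)‖) :
    ∃ m : ℕ, 1 ≤ m ∧ ∃ a : (ZMod (p ^ m))ˣ, 1 ≤ ‖((teichOrbitSum f p m (a : ZMod (p ^ m)) : ℚ) : ℚ_[p])‖ := by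
  classical
  have hp : p.Prime := Fact.out
  by_contra H
  have H' : ∀ m : ℕ, 1 ≤ m → ∀ a : (ZMod (p ^ m))ˣ, ‖((teichOrbitSum f p m (a : ZMod (p ^ m)) : ℚ) : ℚ_[p])‖ < 1 :=
    fun m hm a ↦ not_le.mp fun h ↦ H ⟨m, hm, a, h⟩
  have hαinv : ∀ m : ℕ, ‖α⁻¹ ^ m‖ = 1 := fun m ↦ by rw [norm_pow, norm_inv, hα, inv_one, one_pow]
  have hintμ : ∀ (m : ℕ) (a : ZMod (p ^ m)), ‖msdPlusMeasureMult f α m a‖ ≤ 1 := fun m a ↦ by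
    simp only [msdPlusMeasureMult]; rw [norm_mul, hαinv, one_mul]; exact hint m a
  have hRS : ∀ k m : ℕ, padicLPlusBranchMultRiemannSum f α 0 k m =
      ∑ᶠ ξ : rootsOfUnity (torsionOrder p) ℤ_[p], ∑ s : ZMod (p ^ m),
        msdPlusMeasureMult f α (m + cyclotomicExponent p)
            (PadicInt.toZModPow (m + cyclotomicExponent p) ((ξ : ℤ_[p]ˣ) : ℤ_[p]) *
              (cyclotomicGenerator p : ZMod (p ^ (m + cyclotomicExponent p))) ^ s.val) *
          ((s.val.choose k : ℕ) : ℚ_[p]) := fun k m ↦ by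
    unfold padicLPlusBranchMultRiemannSum; simp only [pow_zero, one_mul]
  have he1 : 1 ≤ cyclotomicExponent p := Nat.pos_of_ne_zero (cyclotomicExponent_ne_zero p)
  -- every `ω⁰` orbit sum of `μ⁺` lies in the ball `p⁻¹`
  have hsmall : ∀ (m : ℕ) (s : ZMod (p ^ m)), ‖∑ᶠ ξ : rootsOfUnity (torsionOrder p) ℤ_[p],
      msdPlusMeasureMult f α (m + cyclotomicExponent p)
        (PadicInt.toZModPow (m + cyclotomicExponent p) ((ξ : ℤ_[p]ˣ) : ℤ_[p]) *
          (cyclotomicGenerator p : ZMod (p ^ (m + cyclotomicExponent p))) ^ s.val)‖ ≤ (p : ℝ)⁻¹ := by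
    intro m s
    have hcl := isUnit_classMap p m ((1 : rootsOfUnity (torsionOrder p) ℤ_[p]), s)
    rw [finsum_msdPlusMeasureMult_coset_eq f α hp2 m 1 s hcl.unit hcl.unit_spec.symm, norm_mul, hαinv, one_mul]
    have hlt := H' (m + cyclotomicExponent p) (by omega) hcl.unit
    have h := (Padic.norm_le_pow_iff_norm_lt_pow_add_one
      ((teichOrbitSum f p (m + cyclotomicExponent p)
        (hcl.unit : ZMod (p ^ (m + cyclotomicExponent p))) : ℚ) : ℚ_[p]) (-1)).mpr
      (by rw [neg_add_cancel, zpow_zero]; exact hlt)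
    rwa [zpow_neg_one] at h
  have hconst : ∀ (m : ℕ) (s s' : ZMod (p ^ m)),
      ‖(∑ᶠ ξ : rootsOfUnity (torsionOrder p) ℤ_[p],
          msdPlusMeasureMult f α (m + cyclotomicExponent p)
            (PadicInt.toZModPow (m + cyclotomicExponent p) ((ξ : ℤ_[p]ˣ) : ℤ_[p]) *
              (cyclotomicGenerator p : ZMod (p ^ (m + cyclotomicExponent p))) ^ s.val)) -
        (∑ᶠ ξ : rootsOfUnity (torsionOrder p) ℤ_[p],
          msdPlusMeasureMult f α (m + cyclotomicExponent p)
            (PadicInt.toZModPow (m + cyclotomicExponent p) ((ξ : ℤ_[p]ˣ) : ℤ_[p]) *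
              (cyclotomicGenerator p : ZMod (p ^ (m + cyclotomicExponent p))) ^ s'.val))‖ ≤
        1 * (p : ℝ)⁻¹ := by
    intro m s s'
    rw [one_mul, sub_eq_add_neg]
    refine (Padic.nonarchimedean _ _).trans (max_le (hsmall m s) ?_)
    rw [norm_neg]
    exact hsmall m s'
  have hle := norm_limUnder_riemannSum_le_of_forall_norm_orbitSum_sub_le
    (μ := msdPlusMeasureMult f α) (RS := padicLPlusBranchMultRiemannSum f α 0) hRS hdist hintμ hconst k
  rw [one_mul] at hle
  rw [coeff_padicLFunctionPlusBranchMult] at hk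
  have hlt : (p : ℝ)⁻¹ < 1 := inv_lt_one_of_one_lt₀ (by exact_mod_cast hp.one_lt)
  exact absurd (hk.trans hle) (not_le.mpr hlt)

/-- **A unit plus symbol at a unit class forces a unit coefficient of SOME EVEN branch of `μ⁺_{f,α}`** (`p` odd, `μ⁺` a `ℤ_p`-valued
distribution, `‖α‖_p = 1`): if `u ∈ (ℤ/p^{n+e₀})ˣ` has `1 ≤ ‖[u/p^{n+e₀}]⁺_f‖_p`, then some `i < p − 1`, `i` EVEN, and some `k` have
`‖[Tᵏ] L⁺_p(f, α, ω^i, T)‖_p = 1` — and `i = 0` ONLY IF the orbit sum `A(u)` is itself a unit.  Mazur–Tate–Teitelbaum §I.13 made kernel by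
`PAdicLFunctionBranchMuCertificateProofs` §1, fed the one-term measure: `u = ξ̄₀ γ^{s₀}` (`X11a.MuCoset.exists_classMap_eq`); orthogonality over
`μ_{p−1}(ℤ_p)` (`exists_lt_norm_branchOrbitSum_of_lt_norm_apply`); evenness (`msdPlusMeasureMult_neg`, `branchOrbitSum_eq_zero_of_odd`); the
branch certificate (`exists_lt_norm_limUnder_weightedRiemannSum_of_lt_norm_branchOrbitSum`, `norm_coeff_padicLFunctionPlusBranchMult_le`); for
`i = 0` the weighted orbit sum is `α^{−(n+e₀)}·A(u)` (`finsum_msdPlusMeasureMult_coset_eq`). [cite: MazurTateTeitelbaum1986Invent, §I.10 (10.1), §I.13]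
[cite: Washington1997, §5.1, §7.2] -/
theorem exists_even_branch_norm_coeff_eq_one_of_unit_symbol [NeZero N] (hp2 : p ≠ 2) (hα : ‖α‖ = 1)
    (hdist : ∀ (n : ℕ) (a : ZMod (p ^ n)),
      ∑ b ∈ Finset.univ.filter (fun b : ZMod (p ^ (n + 1)) ↦
        ZMod.castHom (pow_dvd_pow p n.le_succ) (ZMod (p ^ n)) b = a), msdPlusMeasureMult f α (n + 1) b =
        msdPlusMeasureMult f α n a)
    (hint : ∀ (n : ℕ) (a : ZMod (p ^ n)), ‖((ratPlusSymbol f ((a.val : ℚ) / (p : ℚ) ^ n) : ℚ) : ℚ_[p])‖ ≤ 1)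
    (n : ℕ) (u : (ZMod (p ^ (n + cyclotomicExponent p)))ˣ)
    (hu : 1 ≤ ‖((ratPlusSymbol f (((u : ZMod (p ^ (n + cyclotomicExponent p))).val : ℚ) /
      (p : ℚ) ^ (n + cyclotomicExponent p)) : ℚ) : ℚ_[p])‖) :
    ∃ i < p - 1, Even i ∧
      (i = 0 → 1 ≤ ‖((teichOrbitSum f p (n + cyclotomicExponent p)
        (u : ZMod (p ^ (n + cyclotomicExponent p))) : ℚ) : ℚ_[p])‖) ∧
      ∃ k : ℕ, ‖PowerSeries.coeff k (padicLFunctionPlusBranchMult f α i)‖ = 1 := by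
  classical
  have hp : p.Prime := Fact.out
  have hτ : torsionOrder p = p - 1 := by rw [torsionOrder_eq, if_neg hp2]
  have hαinv : ∀ m : ℕ, ‖α⁻¹ ^ m‖ = 1 := fun m ↦ by rw [norm_pow, norm_inv, hα, inv_one, one_pow]
  have hintμ : ∀ (m : ℕ) (a : ZMod (p ^ m)), ‖msdPlusMeasureMult f α m a‖ ≤ 1 := fun m a ↦ by
    simp only [msdPlusMeasureMult]; rw [norm_mul, hαinv, one_mul]; exact hint m a
  have hint' : ∀ (k m : ℕ), ‖((ratPlusSymbol f ((k : ℚ) / (p : ℚ) ^ m) : ℚ) : ℚ_[p])‖ ≤ 1 := fun k m ↦ by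
    have h := ratPlusSymbol_intCast_div_pow (f := f) (p := p) m (k : ℤ)
    rw [Int.cast_natCast] at h
    rw [h]; exact hint m _
  -- `u = ξ̄₀ γ^{s₀}`; the measure value at that class beats `p⁻¹`
  obtain ⟨ξ₀, s₀, hξs⟩ := X11a.MuCoset.exists_classMap_eq p n u
  have hbig : (1 : ℝ) * (p : ℝ)⁻¹ < ‖msdPlusMeasureMult f α (n + cyclotomicExponent p)
      (PadicInt.toZModPow (n + cyclotomicExponent p) ((ξ₀ : ℤ_[p]ˣ) : ℤ_[p]) *
        (cyclotomicGenerator p : ZMod (p ^ (n + cyclotomicExponent p))) ^ s₀.val)‖ := by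
    rw [hξs, one_mul]
    simp only [msdPlusMeasureMult]
    rw [norm_mul, hαinv, one_mul]
    calc (p : ℝ)⁻¹ < 1 := inv_lt_one_of_one_lt₀ (by exact_mod_cast hp.one_lt)
      _ ≤ _ := hu
  -- some tame character `ω^i` has a weighted orbit sum beating `p⁻¹`; it is even
  obtain ⟨i, hi, hνi⟩ :=
    exists_lt_norm_branchOrbitSum_of_lt_norm_apply (μ := msdPlusMeasureMult f α) hp2 ξ₀ s₀ hbig
  have hieven : Even i := by
    by_contra hodd
    rw [Nat.not_even_iff_odd] at hodd
    have h0 := branchOrbitSum_eq_zero_of_odd (μ := msdPlusMeasureMult f α) hp2 (n := n)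
      (fun b ↦ msdPlusMeasureMult_neg f α _ b) hodd s₀
    rw [h0, norm_zero, one_mul] at hνi
    exact absurd hνi (not_lt.mpr (by positivity))
  -- branch certificate
  obtain ⟨k, -, hk⟩ := exists_lt_norm_limUnder_weightedRiemannSum_of_lt_norm_branchOrbitSum
    (μ := msdPlusMeasureMult f α) (RS := padicLPlusBranchMultRiemannSum f α i) (fun _ _ ↦ rfl) hdist hintμ hνi
  rw [one_mul] at hk
  have hle := norm_coeff_padicLFunctionPlusBranchMult_le f α hdist hintμ i k
  rw [coeff_padicLFunctionPlusBranchMult] at hle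
  refine ⟨i, hτ ▸ hi, hieven, ?_, k, ?_⟩
  · intro hi0
    subst hi0
    simp only [pow_zero, one_mul] at hνi
    rw [finsum_msdPlusMeasureMult_coset_eq f α hp2 n ξ₀ s₀ u hξs, norm_mul, hαinv, one_mul] at hνi
    exact (norm_eq_one_of_inv_lt_of_le_one hνi (norm_teichOrbitSum_le_one hint' _ _)).ge
  · rw [coeff_padicLFunctionPlusBranchMult]
    exact norm_eq_one_of_inv_lt_of_le_one hk hle

end OneTerm

end Summit.BirchSwinnertonDyer.BirchSwinnertonDyer.Theorems.X11aLowerHalfBranch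

end
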